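import Summits.Ventures.Crystal3D.Statement
import Summits.Ventures.Crystal3D.StickySpheres.GraphStratum
import HarnessLib

/-!
# The venture's small-contact-number target, and `C(7) = 15` in the radius-`1` vocabulary

Venture `Crystal3D` (cell `pub-crystal3d`, seat p2). Links the census interface (`GraphStratum.lean`, `ContactSeven.lean`,
`SmallContactTable.lean`) to `Statement.lean`.

* `contactNumber_le_fifteen` — **unconditional**, in the tree's radius-`1` / contact-at-distance-`2` vocabulary
  (`Literature.Barriers.AtomisticToContinuum.contactNumber`, Bezdek's convention): seven points of `ℝ³` pairwise at
  distance `≥ 2` have at most fifteen pairs at distance exactly `2` (from `numContacts_le_fifteen` by halving).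
* `smallContactUpperBounds_of_graphStrata` / `smallContactUpperBounds_of_strata` — the TARGET `SmallContactUpperBounds` of
  `Statement.lean` (`C(9) ≤ 21 ∧ C(10) ≤ 25 ∧ C(11) ≤ 29`) from the four census strata for `n = 8, 9, 10, 11`, in graph form
  (`GSH(4,19,8)`, `GSH(4,22,9)`, `GSH(5,26,10)`, `GSH(5,30,11)`: no graph with exactly that many edges and that minimum degree
  is relaxed-realisable) or in packing form (`S_4(18,8)`, `S_4(21,9)`, `S_5(25,10)`, `S_5(29,11)`); with the equalities
  `smallContact_eq_of_graphStrata`.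

HONEST FRAMING: the strata are hypotheses (the cell's certified enumeration decides them); only the `n ≤ 7` rows are
unconditional. Nothing about crystallization.
-/

noncomputable section

namespace Summit.Ventures.Crystal3D

open Literature.Geometry.DiscreteGeometry (IsUnitBallPacking)
open Literature.Barriers.AtomisticToContinuum (contactNumber)

/-- **`C(7) ≤ 15` in the radius-`1` vocabulary**: for seven distinct points of `ℝ³` whose unit balls do not overlap
(pairwise distance `≥ 2`), at most fifteen pairs are at distance exactly `2`. Unconditional. [folklore] -/
theorem contactNumber_le_fifteen (y : Fin 7 → EuclideanSpace ℝ (Fin 3)) (hy : Function.Injective y)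
    (hP : IsUnitBallPacking (Set.range y)) : contactNumber y ≤ 15 := by
  rw [← numContacts_half_smul]
  exact numContacts_le_fifteen (isUnitPacking_half_smul hy hP)

/-- **The enumeration-lane target from the graph strata**: `GSH(4,19,8)`, `GSH(4,22,9)`, `GSH(5,26,10)`, `GSH(5,30,11)` give
`C(9) ≤ 21`, `C(10) ≤ 25`, `C(11) ≤ 29`. [folklore] -/
theorem smallContactUpperBounds_of_graphStrata (h8 : GraphStratumHypothesis 4 19 8)
    (h9 : GraphStratumHypothesis 4 22 9) (h10 : GraphStratumHypothesis 5 26 10)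
    (h11 : GraphStratumHypothesis 5 30 11) : SmallContactUpperBounds :=
  ⟨(maxContacts_three_nine_of_graphStrata h8 h9).le, (maxContacts_three_ten_of_graphStrata h8 h9 h10).le,
    (maxContacts_three_eleven_of_graphStrata h8 h9 h10 h11).le⟩

/-- **The enumeration-lane target from the packing strata** `S_4(18,8)`, `S_4(21,9)`, `S_5(25,10)`, `S_5(29,11)`. [folklore] -/
theorem smallContactUpperBounds_of_strata (h8 : StratumHypothesisMinDeg 4 18 8) (h9 : StratumHypothesisMinDeg 4 21 9)
    (h10 : StratumHypothesisMinDeg 5 25 10) (h11 : StratumHypothesisMinDeg 5 29 11) : SmallContactUpperBounds :=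
  ⟨(maxContacts_three_nine_of_strata h8 h9).le, (maxContacts_three_ten_of_three_strata h8 h9 h10).le,
    (maxContacts_three_eleven_of_strata h8 h9 h10 h11).le⟩

/-- The printed values `C(8) = 18`, `C(9) = 21`, `C(10) = 25`, `C(11) = 29` from the four graph strata (equalities; the
witnesses are in the tree). [folklore] -/
theorem smallContact_eq_of_graphStrata (h8 : GraphStratumHypothesis 4 19 8) (h9 : GraphStratumHypothesis 4 22 9)
    (h10 : GraphStratumHypothesis 5 26 10) (h11 : GraphStratumHypothesis 5 30 11) :
    maxContacts 3 8 = 18 ∧ maxContacts 3 9 = 21 ∧ maxContacts 3 10 = 25 ∧ maxContacts 3 11 = 29 :=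
  ⟨maxContacts_three_eight_of_graphStratum h8, maxContacts_three_nine_of_graphStrata h8 h9,
    maxContacts_three_ten_of_graphStrata h8 h9 h10, maxContacts_three_eleven_of_graphStrata h8 h9 h10 h11⟩

end Summit.Ventures.Crystal3D

end
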